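import Summits.QuantumFields.BalabanUV.Beta.D1BFx.SliceTransferSources
import Summits.QuantumFields.BalabanUV.Beta.D1BFx.KCombineCovColour

/-!
# `BalabanUV.Beta.D1BFx.KCombineCovColourSrc` — road «BF-x» for binder row D1, slot (K), identity side: **«(A1) v2 WITH SOURCES» STEP 2 —
# THE COLOUR-STRIPPED SLICE TRANSFER WITH THE WARD FAILURES DISPLAYED** (parity-typed colourless jets `kₛ kₜ` antisymmetric, `kₛₜ` symmetric;
# NO one-sided letter `a•`): STEP 1's `SliceTransferSources.hessT_transfer_src` at the colour-lifted data `1⊗K₀, c⊗kₛ, (c·c)⊗kₛₜ, …` — the lifted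
# failures are `c⊗Eₛ`, `(c·c)⊗Eₛₜ` with the COLOURLESS failures `Eₛ = kₛW₀ + K₀wₛ`, `Eₛₜ = kₛₜW₀ + kₛwₜ + kₜwₛ + K₀wₛₜ` — then STRIPPED
# (`tr(c·c)` cancelled): the sharp side at the colourless DEFLATED jets `d̃ₛ = kₛ − (EₛP₀ᵀ − P₀Eₛᵀ) + P₀ZₛP₀ᵀ`, `d̃ₛₜ = kₛₜ − (27 words, with the
# twist signs)`, the Gram side at the TWISTED jets plus the twisted sandwiches `Zₛ = W₀ᵀEₛ`, `Z̃ₛₜ = W₀ᵀEₛₜ − wₛᵀEₜ − wₜᵀEₛ`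

HONEST DEPENDENCY (cell records, verbatim): «continuum YM on T⁴ ⇐ BetaPertH ∧ nine spine estimates (0/9 proved); BetaPertH ⇐ (D1) ∧ (D4) ∧
CAP+tail; G-an2-4 gates asym, D1 and NE2/3/4.»  HONEST FRAMING (cell contract, verbatim): «discharging `BetaPertH` makes Bałaban's UV stability
UNCONDITIONAL — a real constructive-QFT result; it is NOT the continuum limit and NOT the Clay problem.»  THIS MODULE DISCHARGES NOTHING of (K),
of D1 or of the wall: [folklore] finite matrix algebra (Kronecker bookkeeping) over STEP 1 and this lineage's `KCombineCovColour` ∕ gan24-leaf-03's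
`ColourLift` ∕ `GramWeightColourLift` BY NAME, on ABSTRACT data.  No `def`, no `def … : Prop`, nothing cited, 0 sorry.  0 binders discharged; (K)
NOT closed; NOT D1, NOT BetaPertH, NOT continuum, NOT Clay.

ABSOLUTE RULE (cell charter, verbatim): «No internally-minted statement may enter as a cited fact. Every hypothesis is either kernel-proved in this
package or a verbatim quotation of a PUBLISHED theorem with page reference. The manuscript(s) under audit are NOT citable for their own disputed
steps — they are the thing under adjudication; programme-internal (2001/route/tribunal) claims are never citable.»

WHY (owner RULING ρ-g11-10; my INTENT «(A1) v2» l.32839).  `KCombineCovColour.hessT_transfer_wardL_stripped` lifts the parity-typed colourless data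
by an antisymmetric colour matrix `c` so that the honest symmetric-jet transfer applies, then strips.  With sources the same lift works: the lifted
one-sided AND transposed failures coincide (`(c⊗kₛ)ᵀ(1⊗W₀) + (1⊗K₀)ᵀ(c⊗wₛ) = c⊗(kₛW₀ + K₀wₛ)` because `cᵀ = −c`, `kₛᵀ = −kₛ`), so STEP 1
(symmetric jets, failures as free symbols) applies at the lifted data with the lifted letters of §1; the deflated jets and sandwiches of its conclusion
are lifts of COLOURLESS words (§2: every transposed first-order factor flips a sign — the twist), and `tr(c·c)` strips uniformly (§3–§4).
CONTENT (all [folklore]): §1 the lifted letters (`liftE₁`, `liftE_mix`, `liftF₁`, `liftP`, `liftP₀`, `liftΦ₁`, `liftΦ_mix`, `liftZ₁`, `liftZ_mix`);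
§2 the word lifts (`lift_defl₁`: the order-one deflated jet lifts to `c ⊗ d̃ₛ`; `lift_deflMix`: the 27-word mixed deflated jet lifts to `(c·c) ⊗ d̃ₛₜ`);
§3 **`hessT_transfer_src_lift`**; §4 **`hessT_transfer_src_stripped_mul`**, **`hessT_transfer_src_stripped`** — (A1)'s `hessT_transfer_wardL_stripped`
is the case `E• = 0`.  NOT HERE (honest): the dictionary step and the `ℤ⁴` towers (STEP 3), the torus words (STEP 4), any evaluation of `E•`.
Unit `b2b-balaban-beta-d1-formalise-leaf-03` (gen 14), D1 formalisation swarm LEAF PROVER 03; road owner `b2b-balaban-beta-d1-p2`.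
-/

noncomputable section

namespace Summit.QuantumFields.BalabanUV.Beta.D1BFx.KCombineCovColourSrc

open Matrix
open scoped Kronecker
open Literature.MathematicalPhysics.QuantumFieldTheory.Balaban1983to89.Beta.Composition (kkt)
open Summit.QuantumFields.BalabanUV.Beta.D1BFx.MixedVarPackedHess (hessT)
open Summit.QuantumFields.BalabanUV.Beta.D1BFx.GramWeightJets (gram₀ gram₁)
open Summit.QuantumFields.BalabanUV.Beta.D1BFx.GramWeightJetsMixed (gramMix)
open Summit.QuantumFields.BalabanUV.Beta.D1BFx.GramWeightColourLift (tj₂ tgram₁ tgramMix hc_smul gram₀_lift gram₁_lift gramMix_lift lift_mul)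
open Summit.QuantumFields.BalabanUV.Beta.D1BFx.ColourLift
open Summit.QuantumFields.BalabanUV.Beta.D1BFx.ColourLiftPackedHess (tj₂_eq_kkt_mul_sgn sgn_mul_sgn hessT_placement)
open Summit.QuantumFields.BalabanUV.Beta.D1BFx.KCombineCovColour (one_kronecker_add_gram₀ kronecker_add_gram₁ sq_kronecker_add_gramMix
  transpose_kronecker_of_antisymm transpose_one_kronecker transpose_sq_kronecker inv_one_kronecker inv_reindex_one_kronecker kkt_kronecker₂_tj₂
  corner_inv_lift)
open Summit.QuantumFields.BalabanUV.Beta.D1BFx.SliceTransferSources (hessT_transfer_src)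

/-! ## §1 The lifted letters -/

section Letters

variable {l ν ρ : Type*} [Fintype l] [Fintype ν] [Fintype ρ] [DecidableEq l] {c : Matrix l l ℝ}

omit [Fintype ρ] in
/-- [folklore] The lifted first failure: `c⊗E = (c⊗k)(1⊗W₀) + (1⊗K₀)(c⊗w)` when `E = kW₀ + K₀w`. -/
theorem liftE₁ (c : Matrix l l ℝ) {K₀ k : Matrix ν ν ℝ} {W₀ w E : Matrix ν ρ ℝ} (hE : E = k * W₀ + K₀ * w) :
    c ⊗ₖ E = (c ⊗ₖ k) * ((1 : Matrix l l ℝ) ⊗ₖ W₀) + ((1 : Matrix l l ℝ) ⊗ₖ K₀) * (c ⊗ₖ w) := by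
  rw [← Matrix.mul_kronecker_mul, ← Matrix.mul_kronecker_mul, Matrix.mul_one, Matrix.one_mul, ← Matrix.kronecker_add, hE]

omit [Fintype ρ] in
/-- [folklore] The lifted mixed failure: `(c·c)⊗Eₛₜ = ((c·c)⊗kₛₜ)(1⊗W₀) + (c⊗kₛ)(c⊗wₜ) + (c⊗kₜ)(c⊗wₛ) + (1⊗K₀)((c·c)⊗wₛₜ)`. -/
theorem liftE_mix (c : Matrix l l ℝ) {K₀ kₛ kₜ kₛₜ : Matrix ν ν ℝ} {W₀ wₛ wₜ wₛₜ E : Matrix ν ρ ℝ}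
    (hE : E = kₛₜ * W₀ + kₛ * wₜ + kₜ * wₛ + K₀ * wₛₜ) :
    (c * c) ⊗ₖ E = ((c * c) ⊗ₖ kₛₜ) * ((1 : Matrix l l ℝ) ⊗ₖ W₀) + (c ⊗ₖ kₛ) * (c ⊗ₖ wₜ) + (c ⊗ₖ kₜ) * (c ⊗ₖ wₛ)
      + ((1 : Matrix l l ℝ) ⊗ₖ K₀) * ((c * c) ⊗ₖ wₛₜ) := by
  rw [← Matrix.mul_kronecker_mul, ← Matrix.mul_kronecker_mul, ← Matrix.mul_kronecker_mul, ← Matrix.mul_kronecker_mul,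
    Matrix.mul_one, Matrix.one_mul, ← Matrix.kronecker_add, ← Matrix.kronecker_add, ← Matrix.kronecker_add, hE]

/-- [folklore] The lifted FP-Gram inverse: `1⊗P = (gram₀ (1⊗W₀) (1⊗B₀))⁻¹` when `P = (gram₀ W₀ B₀)⁻¹`. -/
theorem liftP [DecidableEq ρ] {B₀ : Matrix ν ν ℝ} {W₀ : Matrix ν ρ ℝ} {P : Matrix ρ ρ ℝ} (hP : P = (gram₀ W₀ B₀)⁻¹) :
    (1 : Matrix l l ℝ) ⊗ₖ P = (gram₀ ((1 : Matrix l l ℝ) ⊗ₖ W₀) ((1 : Matrix l l ℝ) ⊗ₖ B₀))⁻¹ := by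
  rw [gram₀_lift, inv_one_kronecker, hP]

/-- [folklore] The lifted projector: `1⊗P₀ = (1⊗B₀)(1⊗W₀)(1⊗P)` when `P₀ = B₀W₀P`. -/
theorem liftP₀ {B₀ : Matrix ν ν ℝ} {W₀ P₀ : Matrix ν ρ ℝ} {P : Matrix ρ ρ ℝ} (hP₀ : P₀ = B₀ * W₀ * P) :
    (1 : Matrix l l ℝ) ⊗ₖ P₀ = ((1 : Matrix l l ℝ) ⊗ₖ B₀) * ((1 : Matrix l l ℝ) ⊗ₖ W₀) * ((1 : Matrix l l ℝ) ⊗ₖ P) := by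
  rw [← Matrix.mul_kronecker_mul, ← Matrix.mul_kronecker_mul, Matrix.one_mul, Matrix.one_mul, hP₀]

omit [Fintype ρ] in
/-- [folklore] The lifted first FP-Gram jet is TWISTED: `c ⊗ tgram₁ W₀ w B₀ b = gram₁ (1⊗W₀) (c⊗w) (1⊗B₀) (c⊗b)` (`cᵀ = −c`). -/
theorem liftΦ₁ (hc : cᵀ = -c) {B₀ b : Matrix ν ν ℝ} {W₀ w : Matrix ν ρ ℝ} {Φ : Matrix ρ ρ ℝ} (hΦ : Φ = tgram₁ W₀ w B₀ b) :
    c ⊗ₖ Φ = gram₁ ((1 : Matrix l l ℝ) ⊗ₖ W₀) (c ⊗ₖ w) ((1 : Matrix l l ℝ) ⊗ₖ B₀) (c ⊗ₖ b) := by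
  rw [gram₁_lift hc, hΦ]

omit [Fintype ρ] in
/-- [folklore] The lifted mixed FP-Gram jet is TWISTED: `(c·c) ⊗ tgramMix … = gramMix (lifted)` (`cᵀ = −c`). -/
theorem liftΦ_mix (hc : cᵀ = -c) {B₀ bₛ bₜ bₛₜ : Matrix ν ν ℝ} {W₀ wₛ wₜ wₛₜ : Matrix ν ρ ℝ} {Φ : Matrix ρ ρ ℝ}
    (hΦ : Φ = tgramMix W₀ wₛ wₜ wₛₜ B₀ bₛ bₜ bₛₜ) :
    (c * c) ⊗ₖ Φ = gramMix ((1 : Matrix l l ℝ) ⊗ₖ W₀) (c ⊗ₖ wₛ) (c ⊗ₖ wₜ) ((c * c) ⊗ₖ wₛₜ)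
      ((1 : Matrix l l ℝ) ⊗ₖ B₀) (c ⊗ₖ bₛ) (c ⊗ₖ bₜ) ((c * c) ⊗ₖ bₛₜ) := by
  rw [gramMix_lift hc, hΦ]

omit [Fintype ρ] in
/-- [folklore] The lifted weight failure: `c⊗F = (c⊗b)(1⊗W₀) + (1⊗B₀)(c⊗w)` when `F = bW₀ + B₀w` (same shape as `liftE₁`). -/
theorem liftF₁ (c : Matrix l l ℝ) {B₀ b : Matrix ν ν ℝ} {W₀ w F : Matrix ν ρ ℝ} (hF : F = b * W₀ + B₀ * w) :
    c ⊗ₖ F = (c ⊗ₖ b) * ((1 : Matrix l l ℝ) ⊗ₖ W₀) + ((1 : Matrix l l ℝ) ⊗ₖ B₀) * (c ⊗ₖ w) :=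
  liftE₁ c hF

omit [Fintype ρ] in
/-- [folklore] The lifted first sandwich: `c ⊗ (W₀ᵀE) = (1⊗W₀)ᵀ(c⊗E)`. -/
theorem liftZ₁ (c : Matrix l l ℝ) {W₀ E : Matrix ν ρ ℝ} {Z : Matrix ρ ρ ℝ} (hZ : Z = W₀ᵀ * E) :
    c ⊗ₖ Z = ((1 : Matrix l l ℝ) ⊗ₖ W₀)ᵀ * (c ⊗ₖ E) := by
  rw [kronecker_transpose', Matrix.transpose_one, ← Matrix.mul_kronecker_mul, Matrix.one_mul, hZ]

omit [Fintype ρ] in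
/-- [folklore] The lifted mixed sandwich is TWISTED: `(c·c) ⊗ (W₀ᵀEₛₜ − wₛᵀEₜ − wₜᵀEₛ) = (c⊗wₛ)ᵀ(c⊗Eₜ) + (c⊗wₜ)ᵀ(c⊗Eₛ) + (1⊗W₀)ᵀ((c·c)⊗Eₛₜ)`
(`cᵀc = −c·c`). -/
theorem liftZ_mix (hc : cᵀ = -c) {W₀ wₛ wₜ Eₛ Eₜ Eₛₜ : Matrix ν ρ ℝ} {Z : Matrix ρ ρ ℝ} (hZ : Z = W₀ᵀ * Eₛₜ - wₛᵀ * Eₜ - wₜᵀ * Eₛ) :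
    (c * c) ⊗ₖ Z = (c ⊗ₖ wₛ)ᵀ * (c ⊗ₖ Eₜ) + (c ⊗ₖ wₜ)ᵀ * (c ⊗ₖ Eₛ) + ((1 : Matrix l l ℝ) ⊗ₖ W₀)ᵀ * ((c * c) ⊗ₖ Eₛₜ) := by
  rw [kronecker_transpose', kronecker_transpose', kronecker_transpose', Matrix.transpose_one, ← Matrix.mul_kronecker_mul,
    ← Matrix.mul_kronecker_mul, ← Matrix.mul_kronecker_mul, Matrix.one_mul, transpose_mul_self hc, neg_kronecker, neg_kronecker, hZ,
    sub_eq_add_neg, sub_eq_add_neg, Matrix.kronecker_add, Matrix.kronecker_add, kronecker_neg, kronecker_neg]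
  abel

end Letters

/-! ## §2 The word lifts: the deflated jets of the lifted data are lifts of colourless (twisted) words -/

section Words

variable {l ν ρ : Type*} [Fintype l] [Fintype ν] [Fintype ρ] [DecidableEq l] {c : Matrix l l ℝ}

omit [Fintype ν] in
/-- [folklore] **THE ORDER-ONE DEFLATED JET LIFTS TO `c ⊗ d̃ₛ`** with `d̃ₛ := kₛ − (EₛP₀ᵀ − P₀Eₛᵀ) + P₀ZₛP₀ᵀ` — the transposed failure flips
its sign (`(c⊗E)ᵀ = −c⊗Eᵀ`). -/
theorem lift_defl₁ (hc : cᵀ = -c) (k : Matrix ν ν ℝ) (E P₀ : Matrix ν ρ ℝ) (Z : Matrix ρ ρ ℝ) :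
    c ⊗ₖ k - ((c ⊗ₖ E) * ((1 : Matrix l l ℝ) ⊗ₖ P₀)ᵀ + ((1 : Matrix l l ℝ) ⊗ₖ P₀) * (c ⊗ₖ E)ᵀ)
        + ((1 : Matrix l l ℝ) ⊗ₖ P₀) * (c ⊗ₖ Z) * ((1 : Matrix l l ℝ) ⊗ₖ P₀)ᵀ
      = c ⊗ₖ (k - (E * P₀ᵀ - P₀ * Eᵀ) + P₀ * Z * P₀ᵀ) := by
  simp only [kronecker_transpose', Matrix.transpose_one, hc, ← Matrix.mul_kronecker_mul, Matrix.one_mul, Matrix.mul_one, Matrix.mul_neg,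
    neg_kronecker, sub_eq_add_neg, neg_add, neg_neg, Matrix.kronecker_add, kronecker_neg]

omit [Fintype ν] in
/-- [folklore] **THE MIXED DEFLATED JET LIFTS TO `(c·c) ⊗ d̃ₛₜ`**: PART 2e's 27 words at the lifted data (zeroth-order factors `1⊗·`, first-order
`c⊗·`, second-order `(c·c)⊗·`) collect into `(c·c) ⊗` the colourless words with the TWIST SIGNS — every transposed FIRST-order factor contributes
`−1` (`cᵀ = −c`; `(c·c)ᵀ = c·c`). -/
theorem lift_deflMix (hc : cᵀ = -c) (kₛₜ : Matrix ν ν ℝ) (Eₛ Eₜ Eₛₜ Fₛ Fₜ P₀ : Matrix ν ρ ℝ) (P Φₛ Φₜ Zₛ Zₜ Zₛₜ : Matrix ρ ρ ℝ) :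
    (c * c) ⊗ₖ kₛₜ
        - (((c * c) ⊗ₖ Eₛₜ) * ((1 : Matrix l l ℝ) ⊗ₖ P₀)ᵀ + ((1 : Matrix l l ℝ) ⊗ₖ P₀) * ((c * c) ⊗ₖ Eₛₜ)ᵀ
            - ((1 : Matrix l l ℝ) ⊗ₖ P₀) * ((c * c) ⊗ₖ Zₛₜ) * ((1 : Matrix l l ℝ) ⊗ₖ P₀)ᵀ)
        - ((c ⊗ₖ Eₛ) * ((1 : Matrix l l ℝ) ⊗ₖ P) * (c ⊗ₖ Fₜ)ᵀ + (c ⊗ₖ Fₜ) * ((1 : Matrix l l ℝ) ⊗ₖ P) * (c ⊗ₖ Eₛ)ᵀ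
            - (c ⊗ₖ Eₛ) * ((1 : Matrix l l ℝ) ⊗ₖ P) * (c ⊗ₖ Φₜ) * ((1 : Matrix l l ℝ) ⊗ₖ P₀)ᵀ
            - ((1 : Matrix l l ℝ) ⊗ₖ P₀) * (c ⊗ₖ Φₜ) * ((1 : Matrix l l ℝ) ⊗ₖ P) * (c ⊗ₖ Eₛ)ᵀ
            - (c ⊗ₖ Fₜ) * ((1 : Matrix l l ℝ) ⊗ₖ P) * (c ⊗ₖ Zₛ) * ((1 : Matrix l l ℝ) ⊗ₖ P₀)ᵀ
            - ((1 : Matrix l l ℝ) ⊗ₖ P₀) * (c ⊗ₖ Zₛ) * ((1 : Matrix l l ℝ) ⊗ₖ P) * (c ⊗ₖ Fₜ)ᵀ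
            + ((1 : Matrix l l ℝ) ⊗ₖ P₀) * (c ⊗ₖ Zₛ) * ((1 : Matrix l l ℝ) ⊗ₖ P) * (c ⊗ₖ Φₜ) * ((1 : Matrix l l ℝ) ⊗ₖ P₀)ᵀ
            + ((1 : Matrix l l ℝ) ⊗ₖ P₀) * (c ⊗ₖ Φₜ) * ((1 : Matrix l l ℝ) ⊗ₖ P) * (c ⊗ₖ Zₛ) * ((1 : Matrix l l ℝ) ⊗ₖ P₀)ᵀ)
        - ((c ⊗ₖ Fₛ) * ((1 : Matrix l l ℝ) ⊗ₖ P) * (c ⊗ₖ Eₜ)ᵀ + (c ⊗ₖ Eₜ) * ((1 : Matrix l l ℝ) ⊗ₖ P) * (c ⊗ₖ Fₛ)ᵀ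
            - (c ⊗ₖ Fₛ) * ((1 : Matrix l l ℝ) ⊗ₖ P) * (c ⊗ₖ Zₜ) * ((1 : Matrix l l ℝ) ⊗ₖ P₀)ᵀ
            - ((1 : Matrix l l ℝ) ⊗ₖ P₀) * (c ⊗ₖ Zₜ) * ((1 : Matrix l l ℝ) ⊗ₖ P) * (c ⊗ₖ Fₛ)ᵀ
            - (c ⊗ₖ Eₜ) * ((1 : Matrix l l ℝ) ⊗ₖ P) * (c ⊗ₖ Φₛ) * ((1 : Matrix l l ℝ) ⊗ₖ P₀)ᵀ
            - ((1 : Matrix l l ℝ) ⊗ₖ P₀) * (c ⊗ₖ Φₛ) * ((1 : Matrix l l ℝ) ⊗ₖ P) * (c ⊗ₖ Eₜ)ᵀ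
            + ((1 : Matrix l l ℝ) ⊗ₖ P₀) * (c ⊗ₖ Φₛ) * ((1 : Matrix l l ℝ) ⊗ₖ P) * (c ⊗ₖ Zₜ) * ((1 : Matrix l l ℝ) ⊗ₖ P₀)ᵀ
            + ((1 : Matrix l l ℝ) ⊗ₖ P₀) * (c ⊗ₖ Zₜ) * ((1 : Matrix l l ℝ) ⊗ₖ P) * (c ⊗ₖ Φₛ) * ((1 : Matrix l l ℝ) ⊗ₖ P₀)ᵀ)
        - ((c ⊗ₖ Eₛ) * ((1 : Matrix l l ℝ) ⊗ₖ P) * (c ⊗ₖ Eₜ)ᵀ + (c ⊗ₖ Eₜ) * ((1 : Matrix l l ℝ) ⊗ₖ P) * (c ⊗ₖ Eₛ)ᵀ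
            - (c ⊗ₖ Eₛ) * ((1 : Matrix l l ℝ) ⊗ₖ P) * (c ⊗ₖ Zₜ) * ((1 : Matrix l l ℝ) ⊗ₖ P₀)ᵀ
            - ((1 : Matrix l l ℝ) ⊗ₖ P₀) * (c ⊗ₖ Zₜ) * ((1 : Matrix l l ℝ) ⊗ₖ P) * (c ⊗ₖ Eₛ)ᵀ
            - (c ⊗ₖ Eₜ) * ((1 : Matrix l l ℝ) ⊗ₖ P) * (c ⊗ₖ Zₛ) * ((1 : Matrix l l ℝ) ⊗ₖ P₀)ᵀ
            - ((1 : Matrix l l ℝ) ⊗ₖ P₀) * (c ⊗ₖ Zₛ) * ((1 : Matrix l l ℝ) ⊗ₖ P) * (c ⊗ₖ Eₜ)ᵀ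
            + ((1 : Matrix l l ℝ) ⊗ₖ P₀) * (c ⊗ₖ Zₛ) * ((1 : Matrix l l ℝ) ⊗ₖ P) * (c ⊗ₖ Zₜ) * ((1 : Matrix l l ℝ) ⊗ₖ P₀)ᵀ
            + ((1 : Matrix l l ℝ) ⊗ₖ P₀) * (c ⊗ₖ Zₜ) * ((1 : Matrix l l ℝ) ⊗ₖ P) * (c ⊗ₖ Zₛ) * ((1 : Matrix l l ℝ) ⊗ₖ P₀)ᵀ)
      = (c * c) ⊗ₖ (kₛₜ
        - (Eₛₜ * P₀ᵀ + P₀ * Eₛₜᵀ - P₀ * Zₛₜ * P₀ᵀ)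
        - (-(Eₛ * P * Fₜᵀ) - Fₜ * P * Eₛᵀ - Eₛ * P * Φₜ * P₀ᵀ + P₀ * Φₜ * P * Eₛᵀ - Fₜ * P * Zₛ * P₀ᵀ + P₀ * Zₛ * P * Fₜᵀ
            + P₀ * Zₛ * P * Φₜ * P₀ᵀ + P₀ * Φₜ * P * Zₛ * P₀ᵀ)
        - (-(Fₛ * P * Eₜᵀ) - Eₜ * P * Fₛᵀ - Fₛ * P * Zₜ * P₀ᵀ + P₀ * Zₜ * P * Fₛᵀ - Eₜ * P * Φₛ * P₀ᵀ + P₀ * Φₛ * P * Eₜᵀ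
            + P₀ * Φₛ * P * Zₜ * P₀ᵀ + P₀ * Zₜ * P * Φₛ * P₀ᵀ)
        - (-(Eₛ * P * Eₜᵀ) - Eₜ * P * Eₛᵀ - Eₛ * P * Zₜ * P₀ᵀ + P₀ * Zₜ * P * Eₛᵀ - Eₜ * P * Zₛ * P₀ᵀ + P₀ * Zₛ * P * Eₜᵀ
            + P₀ * Zₛ * P * Zₜ * P₀ᵀ + P₀ * Zₜ * P * Zₛ * P₀ᵀ)) := by
  simp only [kronecker_transpose', Matrix.transpose_one, hc, sq_transpose hc, ← Matrix.mul_kronecker_mul, Matrix.one_mul, Matrix.mul_one,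
    Matrix.mul_neg, neg_kronecker, sub_eq_add_neg, neg_add, neg_neg, Matrix.kronecker_add, kronecker_neg, Matrix.mul_assoc]

end Words

/-! ## §3–§4 The stripped slice transfer with sources -/

section Strip

variable {l ν μ ρ : Type*} [Fintype l] [Fintype ν] [Fintype μ] [Fintype ρ] [DecidableEq l] [DecidableEq ν] [DecidableEq μ] [DecidableEq ρ]
variable {c : Matrix l l ℝ}

/-- [folklore] **THE STRIPPED SLICE TRANSFER WITH SOURCES, UP TO THE COLOUR FACTOR `tr(c·c)`** (any antisymmetric `c`).  COLOURLESS typed data: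
`K₀`, `kₛₜ`, `A₀`, `Aₛₜ` symmetric; `kₛ`, `kₜ`, `Aₛ`, `Aₜ` ANTISYMMETRIC; co-frame `T₀ t•`, gauge jets `W₀ w•`, constraint jets `Q₀ q•`, comb rows `τ`;
ONLY the order-zero letter `K₀W₀ = 0`, the kinematic letters, the five `det ≠ 0`; the colourless letters named by hypothesis-equations: twisted weight jets
`B₀ = gram₀ T₀ A₀`, `bₛ = tgram₁ T₀ tₛ A₀ Aₛ`, `bₜ`, `bₛₜ = tgramMix T₀ t• A₀ A•`; failures `Eₛ = kₛW₀ + K₀wₛ`, `Eₜ`, `Eₛₜ = kₛₜW₀ + kₛwₜ + kₜwₛ + K₀wₛₜ`;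
`F• = b•W₀ + B₀w•`; `P = (gram₀ W₀ B₀)⁻¹`, `P₀ = B₀W₀P`; twisted FP-Gram jets `Φₛ = tgram₁ W₀ wₛ B₀ bₛ`, `Φₜ`, `Φₛₜ = tgramMix W₀ w• B₀ b•`; sandwiches
`Zₛ = W₀ᵀEₛ`, `Zₜ = W₀ᵀEₜ` and the TWISTED mixed sandwich `Zₛₜ = W₀ᵀEₛₜ − wₛᵀEₜ − wₜᵀEₛ`.  CONCLUSION: STEP 1 at the lifted data, stripped —
sharp side at the colourless deflated jets `d̃ₛ = kₛ − (EₛP₀ᵀ − P₀Eₛᵀ) + P₀ZₛP₀ᵀ` (signed `tj₂`), `d̃ₛₜ = kₛₜ − (27 twisted words)`, Gram side at `Φ• + Z•`. -/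
theorem hessT_transfer_src_stripped_mul (hc : cᵀ = -c)
    (K₀ kₛ kₜ kₛₜ : Matrix ν ν ℝ) (T₀ tₛ tₜ tₛₜ : Matrix ρ ν ℝ) (A₀ Aₛ Aₜ Aₛₜ : Matrix ρ ρ ℝ)
    (W₀ wₛ wₜ wₛₜ : Matrix ν ρ ℝ) (Q₀ qₛ qₜ qₛₜ : Matrix μ ν ℝ) (τ : Matrix ρ ν ℝ)
    (B₀ bₛ bₜ bₛₜ : Matrix ν ν ℝ) (Eₛ Eₜ Eₛₜ Fₛ Fₜ P₀ : Matrix ν ρ ℝ) (P Φₛ Φₜ Φₛₜ Zₛ Zₜ Zₛₜ : Matrix ρ ρ ℝ)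
    (hK₀ : K₀ᵀ = K₀) (hkₛ : kₛᵀ = -kₛ) (hkₜ : kₜᵀ = -kₜ) (hkₛₜ : kₛₜᵀ = kₛₜ)
    (hA₀ : A₀ᵀ = A₀) (hAₛ : Aₛᵀ = -Aₛ) (hAₜ : Aₜᵀ = -Aₜ) (hAₛₜ : Aₛₜᵀ = Aₛₜ)
    (a0 : K₀ * W₀ = 0)
    (b0 : Q₀ * W₀ = 0) (hqₛ : qₛ * W₀ + Q₀ * wₛ = 0) (hqₜ : qₜ * W₀ + Q₀ * wₜ = 0)
    (hqₛₜ : qₛₜ * W₀ + qₛ * wₜ + qₜ * wₛ + Q₀ * wₛₜ = 0)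
    (hTW : (T₀ * W₀).det ≠ 0) (hA : A₀.det ≠ 0) (hΦ : (gram₀ W₀ (K₀ + gram₀ T₀ A₀)).det ≠ 0) (hτ : (τ * W₀).det ≠ 0)
    (hM : (kkt K₀ (fromRows Q₀ τ)).det ≠ 0)
    (hB₀ : B₀ = gram₀ T₀ A₀) (hbₛ : bₛ = tgram₁ T₀ tₛ A₀ Aₛ) (hbₜ : bₜ = tgram₁ T₀ tₜ A₀ Aₜ) (hbₛₜ : bₛₜ = tgramMix T₀ tₛ tₜ tₛₜ A₀ Aₛ Aₜ Aₛₜ)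
    (hEₛ : Eₛ = kₛ * W₀ + K₀ * wₛ) (hEₜ : Eₜ = kₜ * W₀ + K₀ * wₜ) (hEₛₜ : Eₛₜ = kₛₜ * W₀ + kₛ * wₜ + kₜ * wₛ + K₀ * wₛₜ)
    (hFₛ : Fₛ = bₛ * W₀ + B₀ * wₛ) (hFₜ : Fₜ = bₜ * W₀ + B₀ * wₜ)
    (hP : P = (gram₀ W₀ B₀)⁻¹) (hP₀ : P₀ = B₀ * W₀ * P)
    (hΦₛ : Φₛ = tgram₁ W₀ wₛ B₀ bₛ) (hΦₜ : Φₜ = tgram₁ W₀ wₜ B₀ bₜ) (hΦₛₜ : Φₛₜ = tgramMix W₀ wₛ wₜ wₛₜ B₀ bₛ bₜ bₛₜ)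
    (hZₛ : Zₛ = W₀ᵀ * Eₛ) (hZₜ : Zₜ = W₀ᵀ * Eₜ) (hZₛₜ : Zₛₜ = W₀ᵀ * Eₛₜ - wₛᵀ * Eₜ - wₜᵀ * Eₛ) :
    (c * c).trace *
        (hessT ((kkt K₀ (fromRows Q₀ τ))⁻¹.submatrix (Sum.map id Sum.inl) (Sum.map id Sum.inl))
            (tj₂ (kₛ - (Eₛ * P₀ᵀ - P₀ * Eₛᵀ) + P₀ * Zₛ * P₀ᵀ) qₛ) (tj₂ (kₜ - (Eₜ * P₀ᵀ - P₀ * Eₜᵀ) + P₀ * Zₜ * P₀ᵀ) qₜ)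
            (kkt (kₛₜ
              - (Eₛₜ * P₀ᵀ + P₀ * Eₛₜᵀ - P₀ * Zₛₜ * P₀ᵀ)
              - (-(Eₛ * P * Fₜᵀ) - Fₜ * P * Eₛᵀ - Eₛ * P * Φₜ * P₀ᵀ + P₀ * Φₜ * P * Eₛᵀ - Fₜ * P * Zₛ * P₀ᵀ + P₀ * Zₛ * P * Fₜᵀ
                  + P₀ * Zₛ * P * Φₜ * P₀ᵀ + P₀ * Φₜ * P * Zₛ * P₀ᵀ)
              - (-(Fₛ * P * Eₜᵀ) - Eₜ * P * Fₛᵀ - Fₛ * P * Zₜ * P₀ᵀ + P₀ * Zₜ * P * Fₛᵀ - Eₜ * P * Φₛ * P₀ᵀ + P₀ * Φₛ * P * Eₜᵀ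
                  + P₀ * Φₛ * P * Zₜ * P₀ᵀ + P₀ * Zₜ * P * Φₛ * P₀ᵀ)
              - (-(Eₛ * P * Eₜᵀ) - Eₜ * P * Eₛᵀ - Eₛ * P * Zₜ * P₀ᵀ + P₀ * Zₜ * P * Eₛᵀ - Eₜ * P * Zₛ * P₀ᵀ + P₀ * Zₛ * P * Eₜᵀ
                  + P₀ * Zₛ * P * Zₜ * P₀ᵀ + P₀ * Zₜ * P * Zₛ * P₀ᵀ)) qₛₜ)
          + hessT (gram₀ W₀ (K₀ + B₀))⁻¹ (Φₛ + Zₛ) (Φₜ + Zₜ) (Φₛₜ + Zₛₜ))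
      = (c * c).trace *
        (hessT (kkt (K₀ + B₀) Q₀)⁻¹ (tj₂ (kₛ + bₛ) qₛ) (tj₂ (kₜ + bₜ) qₜ) (kkt (kₛₜ + bₛₜ) qₛₜ)
          + 2 * hessT (τ * W₀)⁻¹ (τ * wₛ) (τ * wₜ) (τ * wₛₜ)) := by
  have hΦL : (gram₀ ((1 : Matrix l l ℝ) ⊗ₖ W₀) ((1 : Matrix l l ℝ) ⊗ₖ K₀
      + gram₀ ((1 : Matrix l l ℝ) ⊗ₖ T₀) ((1 : Matrix l l ℝ) ⊗ₖ A₀))).det ≠ 0 := by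
    rw [one_kronecker_add_gram₀, gram₀_lift]
    exact det_one_kronecker_ne_zero hΦ
  have hB₀L : (1 : Matrix l l ℝ) ⊗ₖ B₀ = gram₀ ((1 : Matrix l l ℝ) ⊗ₖ T₀) ((1 : Matrix l l ℝ) ⊗ₖ A₀) := by rw [gram₀_lift, hB₀]
  have h := hessT_transfer_src ((1 : Matrix l l ℝ) ⊗ₖ K₀) (c ⊗ₖ kₛ) (c ⊗ₖ kₜ) ((c * c) ⊗ₖ kₛₜ)
    ((1 : Matrix l l ℝ) ⊗ₖ T₀) (c ⊗ₖ tₛ) (c ⊗ₖ tₜ) ((c * c) ⊗ₖ tₛₜ)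
    ((1 : Matrix l l ℝ) ⊗ₖ A₀) (c ⊗ₖ Aₛ) (c ⊗ₖ Aₜ) ((c * c) ⊗ₖ Aₛₜ)
    ((1 : Matrix l l ℝ) ⊗ₖ W₀) (c ⊗ₖ wₛ) (c ⊗ₖ wₜ) ((c * c) ⊗ₖ wₛₜ)
    ((1 : Matrix l l ℝ) ⊗ₖ Q₀) (c ⊗ₖ qₛ) (c ⊗ₖ qₜ) ((c * c) ⊗ₖ qₛₜ) ((1 : Matrix l l ℝ) ⊗ₖ τ)
    ((1 : Matrix l l ℝ) ⊗ₖ B₀) (c ⊗ₖ bₛ) (c ⊗ₖ bₜ) ((c * c) ⊗ₖ bₛₜ)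
    (c ⊗ₖ Eₛ) (c ⊗ₖ Eₜ) ((c * c) ⊗ₖ Eₛₜ) (c ⊗ₖ Fₛ) (c ⊗ₖ Fₜ) ((1 : Matrix l l ℝ) ⊗ₖ P₀)
    ((1 : Matrix l l ℝ) ⊗ₖ P) (c ⊗ₖ Φₛ) (c ⊗ₖ Φₜ) ((c * c) ⊗ₖ Φₛₜ) (c ⊗ₖ Zₛ) (c ⊗ₖ Zₜ) ((c * c) ⊗ₖ Zₛₜ)
    (transpose_one_kronecker hK₀) (transpose_kronecker_of_antisymm hc hkₛ) (transpose_kronecker_of_antisymm hc hkₜ)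
    (transpose_sq_kronecker hc hkₛₜ)
    (transpose_one_kronecker hA₀) (transpose_kronecker_of_antisymm hc hAₛ) (transpose_kronecker_of_antisymm hc hAₜ)
    (transpose_sq_kronecker hc hAₛₜ)
    (lift_rel₀ a0) (lift_rel₀ b0) (lift_rel₁ c hqₛ) (lift_rel₁ c hqₜ) (lift_rel_mix c hqₛₜ)
    (det_lift_mul_ne_zero hTW) (det_one_kronecker_ne_zero hA) hΦL (det_lift_mul_ne_zero hτ) (det_kkt_lift_ne_zero hM)
    hB₀L (liftΦ₁ hc hbₛ) (liftΦ₁ hc hbₜ) (liftΦ_mix hc hbₛₜ)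
    (liftE₁ c hEₛ) (liftE₁ c hEₜ) (liftE_mix c hEₛₜ) (liftF₁ c hFₛ) (liftF₁ c hFₜ) (liftP hP) (liftP₀ hP₀)
    (liftΦ₁ hc hΦₛ) (liftΦ₁ hc hΦₜ) (liftΦ_mix hc hΦₛₜ) (liftZ₁ c hZₛ) (liftZ₁ c hZₜ) (liftZ_mix hc hZₛₜ)
  rw [lift_defl₁ hc, lift_defl₁ hc, lift_deflMix hc] at h
  simp only [← Matrix.kronecker_add] at h
  rw [-- M-side
    kkt_kronecker_symm Matrix.transpose_one, corner_inv_lift, kkt_kronecker₂_tj₂ hc, kkt_kronecker₂_tj₂ hc,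
    kkt_kronecker₂_symm (sq_transpose hc), hessT_reindex_lift, hessT_kronecker_lift,
    -- Φ-side
    gram₀_lift, inv_one_kronecker, hessT_kronecker_lift,
    -- N-side
    kkt_kronecker₂_symm Matrix.transpose_one, kkt_kronecker₂_tj₂ hc, kkt_kronecker₂_tj₂ hc, kkt_kronecker₂_symm (sq_transpose hc),
    inv_reindex_one_kronecker, hessT_reindex_lift, hessT_kronecker_lift,
    -- comb-FP side
    lift_mul, lift_mul, lift_mul, lift_mul, inv_one_kronecker, hessT_kronecker_lift] at h
  linear_combination h

/-- [folklore] **«(A1) v2» STEP 2 — THE COLOUR-STRIPPED SLICE TRANSFER WITH SOURCES** (`c = cgen`, `tr(C²) = −2` cancelled): for COLOURLESS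
typed data (`K₀`, `kₛₜ`, `A₀`, `Aₛₜ` symmetric, `kₛ`, `kₜ`, `Aₛ`, `Aₜ` antisymmetric) with ONLY `K₀W₀ = 0`, the kinematic letters and the five
`det ≠ 0`, and with the failures ∕ sandwiches ∕ twisted jets named as in `hessT_transfer_src_stripped_mul`:
`hessT (M⁻¹|_{ν⊕μ}; tj₂ d̃ₛ qₛ, tj₂ d̃ₜ qₜ, kkt d̃ₛₜ qₛₜ) + hessT (Φ₀⁻¹; Φₛ + Zₛ, Φₜ + Zₜ, Φₛₜ + Zₛₜ) = hessT ((kkt (K₀+B₀) Q₀)⁻¹; tj₂ (kₛ+bₛ) qₛ,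
tj₂ (kₜ+bₜ) qₜ, kkt (kₛₜ+bₛₜ) qₛₜ) + 2·hessT ((τW₀)⁻¹; τw•)`.  `KCombineCovColour.hessT_transfer_wardL_stripped` is the case `E• = 0`. -/
theorem hessT_transfer_src_stripped
    (K₀ kₛ kₜ kₛₜ : Matrix ν ν ℝ) (T₀ tₛ tₜ tₛₜ : Matrix ρ ν ℝ) (A₀ Aₛ Aₜ Aₛₜ : Matrix ρ ρ ℝ)
    (W₀ wₛ wₜ wₛₜ : Matrix ν ρ ℝ) (Q₀ qₛ qₜ qₛₜ : Matrix μ ν ℝ) (τ : Matrix ρ ν ℝ)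
    (B₀ bₛ bₜ bₛₜ : Matrix ν ν ℝ) (Eₛ Eₜ Eₛₜ Fₛ Fₜ P₀ : Matrix ν ρ ℝ) (P Φₛ Φₜ Φₛₜ Zₛ Zₜ Zₛₜ : Matrix ρ ρ ℝ)
    (hK₀ : K₀ᵀ = K₀) (hkₛ : kₛᵀ = -kₛ) (hkₜ : kₜᵀ = -kₜ) (hkₛₜ : kₛₜᵀ = kₛₜ)
    (hA₀ : A₀ᵀ = A₀) (hAₛ : Aₛᵀ = -Aₛ) (hAₜ : Aₜᵀ = -Aₜ) (hAₛₜ : Aₛₜᵀ = Aₛₜ)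
    (a0 : K₀ * W₀ = 0)
    (b0 : Q₀ * W₀ = 0) (hqₛ : qₛ * W₀ + Q₀ * wₛ = 0) (hqₜ : qₜ * W₀ + Q₀ * wₜ = 0)
    (hqₛₜ : qₛₜ * W₀ + qₛ * wₜ + qₜ * wₛ + Q₀ * wₛₜ = 0)
    (hTW : (T₀ * W₀).det ≠ 0) (hA : A₀.det ≠ 0) (hΦ : (gram₀ W₀ (K₀ + gram₀ T₀ A₀)).det ≠ 0) (hτ : (τ * W₀).det ≠ 0)
    (hM : (kkt K₀ (fromRows Q₀ τ)).det ≠ 0)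
    (hB₀ : B₀ = gram₀ T₀ A₀) (hbₛ : bₛ = tgram₁ T₀ tₛ A₀ Aₛ) (hbₜ : bₜ = tgram₁ T₀ tₜ A₀ Aₜ) (hbₛₜ : bₛₜ = tgramMix T₀ tₛ tₜ tₛₜ A₀ Aₛ Aₜ Aₛₜ)
    (hEₛ : Eₛ = kₛ * W₀ + K₀ * wₛ) (hEₜ : Eₜ = kₜ * W₀ + K₀ * wₜ) (hEₛₜ : Eₛₜ = kₛₜ * W₀ + kₛ * wₜ + kₜ * wₛ + K₀ * wₛₜ)
    (hFₛ : Fₛ = bₛ * W₀ + B₀ * wₛ) (hFₜ : Fₜ = bₜ * W₀ + B₀ * wₜ)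
    (hP : P = (gram₀ W₀ B₀)⁻¹) (hP₀ : P₀ = B₀ * W₀ * P)
    (hΦₛ : Φₛ = tgram₁ W₀ wₛ B₀ bₛ) (hΦₜ : Φₜ = tgram₁ W₀ wₜ B₀ bₜ) (hΦₛₜ : Φₛₜ = tgramMix W₀ wₛ wₜ wₛₜ B₀ bₛ bₜ bₛₜ)
    (hZₛ : Zₛ = W₀ᵀ * Eₛ) (hZₜ : Zₜ = W₀ᵀ * Eₜ) (hZₛₜ : Zₛₜ = W₀ᵀ * Eₛₜ - wₛᵀ * Eₜ - wₜᵀ * Eₛ) :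
    hessT ((kkt K₀ (fromRows Q₀ τ))⁻¹.submatrix (Sum.map id Sum.inl) (Sum.map id Sum.inl))
        (tj₂ (kₛ - (Eₛ * P₀ᵀ - P₀ * Eₛᵀ) + P₀ * Zₛ * P₀ᵀ) qₛ) (tj₂ (kₜ - (Eₜ * P₀ᵀ - P₀ * Eₜᵀ) + P₀ * Zₜ * P₀ᵀ) qₜ)
        (kkt (kₛₜ
          - (Eₛₜ * P₀ᵀ + P₀ * Eₛₜᵀ - P₀ * Zₛₜ * P₀ᵀ)
          - (-(Eₛ * P * Fₜᵀ) - Fₜ * P * Eₛᵀ - Eₛ * P * Φₜ * P₀ᵀ + P₀ * Φₜ * P * Eₛᵀ - Fₜ * P * Zₛ * P₀ᵀ + P₀ * Zₛ * P * Fₜᵀ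
              + P₀ * Zₛ * P * Φₜ * P₀ᵀ + P₀ * Φₜ * P * Zₛ * P₀ᵀ)
          - (-(Fₛ * P * Eₜᵀ) - Eₜ * P * Fₛᵀ - Fₛ * P * Zₜ * P₀ᵀ + P₀ * Zₜ * P * Fₛᵀ - Eₜ * P * Φₛ * P₀ᵀ + P₀ * Φₛ * P * Eₜᵀ
              + P₀ * Φₛ * P * Zₜ * P₀ᵀ + P₀ * Zₜ * P * Φₛ * P₀ᵀ)
          - (-(Eₛ * P * Eₜᵀ) - Eₜ * P * Eₛᵀ - Eₛ * P * Zₜ * P₀ᵀ + P₀ * Zₜ * P * Eₛᵀ - Eₜ * P * Zₛ * P₀ᵀ + P₀ * Zₛ * P * Eₜᵀ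
              + P₀ * Zₛ * P * Zₜ * P₀ᵀ + P₀ * Zₜ * P * Zₛ * P₀ᵀ)) qₛₜ)
      + hessT (gram₀ W₀ (K₀ + B₀))⁻¹ (Φₛ + Zₛ) (Φₜ + Zₜ) (Φₛₜ + Zₛₜ)
    = hessT (kkt (K₀ + B₀) Q₀)⁻¹ (tj₂ (kₛ + bₛ) qₛ) (tj₂ (kₜ + bₜ) qₜ) (kkt (kₛₜ + bₛₜ) qₛₜ)
      + 2 * hessT (τ * W₀)⁻¹ (τ * wₛ) (τ * wₜ) (τ * wₛₜ) := by
  have h := hessT_transfer_src_stripped_mul cgen_transpose K₀ kₛ kₜ kₛₜ T₀ tₛ tₜ tₛₜ A₀ Aₛ Aₜ Aₛₜ W₀ wₛ wₜ wₛₜ Q₀ qₛ qₜ qₛₜ τ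
    B₀ bₛ bₜ bₛₜ Eₛ Eₜ Eₛₜ Fₛ Fₜ P₀ P Φₛ Φₜ Φₛₜ Zₛ Zₜ Zₛₜ hK₀ hkₛ hkₜ hkₛₜ hA₀ hAₛ hAₜ hAₛₜ a0 b0 hqₛ hqₜ hqₛₜ hTW hA hΦ hτ hM
    hB₀ hbₛ hbₜ hbₛₜ hEₛ hEₜ hEₛₜ hFₛ hFₜ hP hP₀ hΦₛ hΦₜ hΦₛₜ hZₛ hZₜ hZₛₜ
  rw [trace_cgen_mul_cgen] at h
  linarith

end Strip

end Summit.QuantumFields.BalabanUV.Beta.D1BFx.KCombineCovColourSrc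

end
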